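import Literature.AnabelianGeometry.SemiGraphs.TemperedLocalLevelEstrangementDistinct
import Literature.AnabelianGeometry.SemiGraphs.GaloisLevelDescent
import HarnessLib

/-!
# [SemiAnbd] Thm 3.7 (iii) beyond finite `𝔾`: ESTRANGEMENT IN DEPTH at the canonical tower —
# the SAME-base-branch half: two fixed edges over one branch fold at any reference level

Mochizuki, *Semi-graphs of anabelioids*, Publ. RIMS **42** (2006), §2 Def. 2.4 (iv) p. 26 (estranged, the
clause `b' = b`, `g ∉ Π_b`: "`Π_b ∩ g·Π_b·g⁻¹ = 1`") and §3 Theorem 3.7 (iii), proof p. 41 with the author's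
*Comments* (2020) (6)(b) [cite: MochizukiSemiAnbd2006, Thm 3.7(iii) p.41].

PROOF-ONLY (cell abc-iut, layer L3, GAP row G-t6g3-2b «no escape», binder `hbdd`; seat abc-iut-w6-d062,
brick B1b(ii) of the desk memo HOME/staging/w6/w6-d062/HBDD-LOCFIN-memo.md §2, completing
`TemperedLocalLevelEstrangementDistinct.lean`).  At the canonical tower `D := 𝒢.galoisLevelData h36`, for an
element `c` of `π₁^temp(𝒢)` non-trivial at a level `j₀`, a base vertex `w`, ONE branch `b` of `𝔾` at `w` and a
reference level `j`: there is a level `k` such that at every level `k' ≥ k`, at the vertex `P.vertex k'` of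
any compatible point sequence `P` over `w`, two tree edges of branches over `b` fixed by `c` have branches
with THE SAME IMAGE in `𝔾̃_j` (`eventually_fold_same_base_pair`) — the malnormal clause of estrangement in
depth.  Ingredients:

* the LINKED single-level branch dictionary `PointSeq.exists_gal_conj_brHom_of_edgeMap_brOf_eq` — abc-iut-L3-t11's
  `exists_gal_conj_brHom_of_orbitGraphMap_branchMap_eq` (TemperedPiBranchStabilizerImage.lean, Rmk 2.2.1 at one
  level) with the conjugator EXPOSED: for the branch `brOf b (g · P.pt n)` one gets
  `ρ_n(c) = σ_n^{g⁻¹ b_*(k) g}` (print: "well-defined up to conjugation" — the conjugator records the branch);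
* transport of `brOf` along the tree transitions (`treeTrans_branchMap_brOf_smul_pt`: the level-`j` image of
  `brOf b (g · P.pt n)` is `brOf b (g · P.pt j)` — abc-iut-L3-t9/t6's `orbitGraphMap_stepCover`,
  `CovObj.branchMap_orbitGraphMap_brOf`, equivariance of the covering maps);
* «distinct images at level `j`» ⇒ the relative conjugator `m = g₁g₂⁻¹` avoids `Π_b · N j` (`N` the level
  kernels of `Π_w`; `CovObj.brOf_eq_brOf_iff`), a COMPACT conjugator range on which `Π_b ∩ mΠ_bm⁻¹ = 1`
  (`IsEstrangedEdge`, clause `b' = b`); then `EstrangementDepth.exists_level_mul_inter_mul_subset` exactly as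
  in the distinct-branch half.

Nothing here bears on [IUTchIII] Cor. 3.12; typed ≠ proved elsewhere.
-/

namespace Literature.AnabelianGeometry.SemiGraphs

namespace ProfiniteSemiGraph

namespace GaloisLevelData

open CategoryTheory Topology
open scoped Pointwise
open Literature.AlgebraicGeometry.Frobenioids.QuasiTemperoid.BTempConnected (ρ_one_apply
  ρ_mul_apply ρ_inv_apply)

universe u

variable {𝒢 : ProfiniteSemiGraph.{u}} (D : GaloisLevelData 𝒢) (h𝒢 : 𝒢.IsCountable)

/-! ### Transport of `brOf` along the tree transitions -/

/-- One step: the transition `𝔾̃_{n+1} → 𝔾̃_n` sends the branch through `y` to the branch through the image of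
`y` under the covering map. [cite: MochizukiSemiAnbd2006, Prop 3.6 p.38] -/
theorem treeStep_branchMap_brOf (n : ℕ) (b : 𝒢.graph.Branch) {w : 𝒢.graph.Vertex}
    (hb : 𝒢.graph.abuts b = some w) (y : ((D.cover h𝒢 (n + 1)).SV w).obj.V) :
    (D.treeStep n).branchMap ((D.treeIso h𝒢 (n + 1)).hom.branchMap ((D.cover h𝒢 (n + 1)).brOf b hb y)) =
      (D.treeIso h𝒢 n).hom.branchMap
        ((D.cover h𝒢 n).brOf b hb (((D.stepCover h𝒢 n).fV w).hom.hom y)) := by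
  have h := congrArg (fun φ => SemiGraph.Hom.branchMap φ ((D.cover h𝒢 (n + 1)).brOf b hb y))
    (D.orbitGraphMap_stepCover h𝒢 n)
  simp only [SemiGraph.comp_branchMap, Function.comp_apply] at h
  rw [← h, CovObj.branchMap_orbitGraphMap_brOf]

namespace PointSeq

variable {D h𝒢} {w : 𝒢.graph.Vertex} (P : D.PointSeq h𝒢 w)

/-- **Transport of `brOf b (g · P.pt n)` along the transitions**: its image in `𝔾̃_j` (`j ≤ n`) is
`brOf b (g · P.pt j)` (the covering maps are `Π_w`-equivariant and the point sequence is compatible).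
[cite: MochizukiSemiAnbd2006, Prop 3.6 p.38] -/
theorem treeTrans_branchMap_brOf_smul_pt (b : 𝒢.graph.Branch) (hb : 𝒢.graph.abuts b = some w) (g : 𝒢.Gv w)
    {j n : ℕ} (h : j ≤ n) :
    (D.treeTrans h).branchMap ((D.treeIso h𝒢 n).hom.branchMap
        ((D.cover h𝒢 n).brOf b hb (((D.cover h𝒢 n).SV w).obj.ρ g (P.pt n)))) =
      (D.treeIso h𝒢 j).hom.branchMap ((D.cover h𝒢 j).brOf b hb (((D.cover h𝒢 j).SV w).obj.ρ g (P.pt j))) := by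
  induction n, h using Nat.le_induction with
  | base => rw [D.treeTrans_self]; rfl
  | succ k h ih =>
    have hstep : ((D.stepCover h𝒢 k).fV w).hom.hom (((D.cover h𝒢 (k + 1)).SV w).obj.ρ g (P.pt (k + 1))) =
        ((D.cover h𝒢 k).SV w).obj.ρ g (P.pt k) := by
      rw [CovHom.fV_ρ, P.compat k]
    rw [D.treeTrans_succ h, SemiGraph.comp_branchMap, Function.comp_apply,
      D.treeStep_branchMap_brOf h𝒢 k b hb, hstep, ih]

/-! ### The linked single-level branch dictionary -/

/-- **Rmk 2.2.1 at one level, conjugator exposed**: if `c ∈ π₁^temp(𝒢)` fixes, at level `n`, the edge of the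
tree branch `brOf b (g · P.pt n)` at `P.vertex n`, then `ρ_n(c) = σ_n^{g⁻¹ b_*(k) g}` for some `k ∈ Π_e`
(abc-iut-L3-t11's `exists_gal_conj_brHom_of_orbitGraphMap_branchMap_eq` with the conjugator `g⁻¹` of ITS
proof made explicit). [cite: MochizukiSemiAnbd2006, Rmk 2.2.1 p.24] -/
theorem exists_gal_conj_brHom_of_edgeMap_brOf_eq (n : ℕ) (c : D.temperedPi h𝒢)
    (b : 𝒢.graph.Branch) (hb : 𝒢.graph.abuts b = some w) (g : 𝒢.Gv w)
    (hfix : (D.treeAct h𝒢 n c).hom.edgeMap ((D.tree n).edgeOf ((D.treeIso h𝒢 n).hom.branchMap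
        ((D.cover h𝒢 n).brOf b hb (((D.cover h𝒢 n).SV w).obj.ρ g (P.pt n))))) =
      (D.tree n).edgeOf ((D.treeIso h𝒢 n).hom.branchMap
        ((D.cover h𝒢 n).brOf b hb (((D.cover h𝒢 n).SV w).obj.ρ g (P.pt n))))) :
    ∃ k : 𝒢.Ge (𝒢.graph.edgeOf b), D.proj h𝒢 n c = P.gal n (g⁻¹ * 𝒢.brHom b w hb k * g⁻¹⁻¹) := by
  set y := ((D.cover h𝒢 n).SV w).obj.ρ g (P.pt n) with hy
  set β := (D.treeIso h𝒢 n).hom.branchMap ((D.cover h𝒢 n).brOf b hb y) with hβ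
  -- the branch itself is fixed (the action is over `𝔾`)
  have hfixβ : (D.treeAct h𝒢 n c).hom.branchMap β = β :=
    SemiGraph.branchMap_eq_of_over_aut (D.treeProj n) (D.treeAct h𝒢 n c) (D.treeAct_over h𝒢 n c) β hfix
  -- in cover coordinates: `σ · brOf b y = brOf b y` for `σ = ρ_n(c)`
  set σ := D.proj h𝒢 n c with hσ
  have hfix₀ : (CovObj.orbitGraphMap σ.hom).branchMap ((D.cover h𝒢 n).brOf b hb y) =
      (D.cover h𝒢 n).brOf b hb y := by
    have h1 := hfixβ
    rw [hβ, D.treeAct_apply, D.galTreeAct_branchMap_treeIso h𝒢] at h1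
    have h2 := congrArg (D.treeIso h𝒢 n).inv.branchMap h1
    rw [D.treeIso_inv_branchMap_hom h𝒢, D.treeIso_inv_branchMap_hom h𝒢] at h2
    exact h2
  -- `σ · brOf b y = brOf b (σ y)`, so `σ y = k · y` with `k ∈ Π_b`
  rw [(D.cover h𝒢 n).branchMap_brOf b hb σ y, (D.cover h𝒢 n).brOf_eq_brOf_iff b hb] at hfix₀
  obtain ⟨k', ⟨k, rfl⟩, hk⟩ := hfix₀
  have hk' : (𝒢.brHom b w hb).toMonoidHom k = 𝒢.brHom b w hb k := rfl
  rw [hk'] at hk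
  refine ⟨k, P.eq_gal n _ σ ?_⟩
  -- `σ y = b_*(k)⁻¹ · y` with `y = g · P.pt n`, hence `σ (P.pt n) = (g⁻¹ b_*(k)⁻¹ g) · P.pt n`
  have h1 : (σ.hom.fV w).hom.hom y = ((D.cover h𝒢 n).SV w).obj.ρ (𝒢.brHom b w hb k)⁻¹ y := by
    have h2 := congrArg (((D.cover h𝒢 n).SV w).obj.ρ (𝒢.brHom b w hb k)⁻¹) hk
    rw [← ρ_mul_apply, inv_mul_cancel, ρ_one_apply] at h2
    exact h2
  rw [hy, CovHom.fV_ρ] at h1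
  have h3 := congrArg (((D.cover h𝒢 n).SV w).obj.ρ g⁻¹) h1
  rw [← ρ_mul_apply, inv_mul_cancel, ρ_one_apply, ← ρ_mul_apply, ← ρ_mul_apply] at h3
  rw [h3]
  have h4 : (g⁻¹ * 𝒢.brHom b w hb k * g⁻¹⁻¹)⁻¹ = g⁻¹ * (𝒢.brHom b w hb k)⁻¹ * g := by group
  rw [h4]

end PointSeq

end GaloisLevelData

/-! ### The depth lemma at the canonical tower, same base branch -/

section Canonical

open CategoryTheory Topology
open scoped Pointwise
open Literature.AlgebraicGeometry.Frobenioids.QuasiTemperoid.BTempConnected (ρ_one_apply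
  ρ_mul_apply ρ_inv_apply)

universe u

variable (𝒢 : ProfiniteSemiGraph.{u}) (h37 : 𝒢.Thm37Hypotheses)

/-- **Estrangement in depth, one base branch (malnormal clause).**  For the canonical tower, `c` non-trivial at
level `j₀`, a base vertex `w`, a branch `b` of `𝔾` at `w` and a reference level `j`: there is `k ≥ j₀, j` such
that at every level `k' ≥ k` and every compatible point sequence `P` over `w`, two tree branches at
`P.vertex k'` lying over `b` whose edges are fixed by `c` have THE SAME image in `𝔾̃_j`.
[cite: MochizukiSemiAnbd2006, Thm 3.7(iii) p.41] -/
theorem eventually_fold_same_base_pair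
    (c : (𝒢.temperedPiChart h37.toProp36Hypotheses).G) (j₀ : ℕ)
    (hc : (𝒢.galoisLevelData h37.toProp36Hypotheses).proj h37.toProp36Hypotheses.isCountable j₀ c ≠ 1)
    (w : 𝒢.graph.Vertex) {b : 𝒢.graph.Branch} (hb : 𝒢.graph.abuts b = some w) (j : ℕ) :
    ∃ k : ℕ, j₀ ≤ k ∧ j ≤ k ∧ ∀ (k' : ℕ) (hkk' : k ≤ k'),
      ∀ (P : (𝒢.galoisLevelData h37.toProp36Hypotheses).PointSeq h37.toProp36Hypotheses.isCountable w)
        (β₁ β₂ : ((𝒢.galoisLevelData h37.toProp36Hypotheses).tree k').Branch),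
        ((𝒢.galoisLevelData h37.toProp36Hypotheses).treeProj k').branchMap β₁ = b →
        ((𝒢.galoisLevelData h37.toProp36Hypotheses).treeProj k').branchMap β₂ = b →
        ((𝒢.galoisLevelData h37.toProp36Hypotheses).tree k').abuts β₁ = some (P.vertex k') →
        ((𝒢.galoisLevelData h37.toProp36Hypotheses).tree k').abuts β₂ = some (P.vertex k') →
        ((𝒢.galoisLevelData h37.toProp36Hypotheses).treeAct h37.toProp36Hypotheses.isCountable k' c).hom.edgeMap
            (((𝒢.galoisLevelData h37.toProp36Hypotheses).tree k').edgeOf β₁) =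
          ((𝒢.galoisLevelData h37.toProp36Hypotheses).tree k').edgeOf β₁ →
        ((𝒢.galoisLevelData h37.toProp36Hypotheses).treeAct h37.toProp36Hypotheses.isCountable k' c).hom.edgeMap
            (((𝒢.galoisLevelData h37.toProp36Hypotheses).tree k').edgeOf β₂) =
          ((𝒢.galoisLevelData h37.toProp36Hypotheses).tree k').edgeOf β₂ →
        ∀ hjk' : j ≤ k',
        ((𝒢.galoisLevelData h37.toProp36Hypotheses).treeTrans hjk').branchMap β₁ =
          ((𝒢.galoisLevelData h37.toProp36Hypotheses).treeTrans hjk').branchMap β₂ := by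
  classical
  haveI : T1Space (𝒢.Gv w) :=
    ⟨fun x => connectedComponent_eq_singleton x ▸ isClosed_connectedComponent⟩
  haveI : T2Space (𝒢.Gv w) := inferInstance
  -- notation
  let D := 𝒢.galoisLevelData h37.toProp36Hypotheses
  let hcnt := h37.toProp36Hypotheses.isCountable
  -- the level kernels `N n` of `Π_w` on the finite Galois levels `(S n)_w`
  let N : ℕ → Subgroup (𝒢.Gv w) := fun n =>
    { carrier := {h | ∀ x : ((D.S n).SV w).obj.V, ((D.S n).SV w).obj.ρ h x = x}
      one_mem' := fun x => ρ_one_apply _ x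
      mul_mem' := fun {a b} ha hb x => by rw [ρ_mul_apply, hb x, ha x]
      inv_mem' := fun {a} ha x => by
        conv_lhs => rw [← ha x]
        exact ρ_inv_apply _ a x }
  have hN : ∀ (n : ℕ) (h : 𝒢.Gv w), h ∈ N n ↔
      ∀ x : ((D.S n).SV w).obj.V, ((D.S n).SV w).obj.ρ h x = x := fun n h => Iff.rfl
  have hopen : ∀ n, IsOpen (N n : Set (𝒢.Gv w)) := fun n =>
    D.isOpen_levelKernel w N hN n (𝒢.galoisLevelData_isFinite h37.toProp36Hypotheses n)
  have hanti : Antitone N := D.levelKernel_antitone w N hN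
    fun n => 𝒢.towerMap_fV_surjective h37.toProp36Hypotheses n w
  have hdir : ∀ i i', ∃ k, N k ≤ N i ∧ N k ≤ N i' := fun i i' =>
    ⟨max i i', hanti (le_max_left i i'), hanti (le_max_right i i')⟩
  have hbot : ∀ g : 𝒢.Gv w, (∀ i, g ∈ N i) → g = 1 := fun g hg =>
    𝒢.galoisLevelData_faithfulV h37 w g fun n x => (hN n g).1 (hg n) x
  have hnormal : ∀ n, (N n).Normal := fun n => D.levelKernel_normal w N hN n
  -- the branch subgroup and the compact range of conjugators «distinct at level j»
  let A : Set (𝒢.Gv w) := (𝒢.branchSubgroup b w hb : Set (𝒢.Gv w))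
  have hA : IsCompact A := by
    change IsCompact ((𝒢.brHom b w hb).toMonoidHom.range : Set (𝒢.Gv w))
    rw [MonoidHom.coe_range]
    exact isCompact_range (𝒢.brHom b w hb).continuous
  let M : Set (𝒢.Gv w) := (A * (N j : Set (𝒢.Gv w)))ᶜ
  have hM : IsCompact M := Literature.GroupTheory.EstrangementDepth.isCompact_compl_mul_of_isOpen A (N j) (hopen j)
  have hest : ∀ m ∈ M, ∀ a ∈ A, ∀ a' ∈ A, a = m * a' * m⁻¹ → a = 1 := by
    refine Literature.GroupTheory.EstrangementDepth.conj_disjoint_of_inf_map_conj_eq_bot _ _ _ fun m hm => ?_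
    have hmA : m ∉ 𝒢.branchSubgroup b w hb := fun hmA =>
      hm (Set.mem_mul.mpr ⟨m, hmA, 1, (N j).one_mem, mul_one m⟩)
    exact (h37.isTotallyEstranged (𝒢.graph.edgeOf b)).2 b rfl w hb b hb m (Or.inr hmA)
  -- the depth level
  obtain ⟨k₁, hk₁⟩ := Literature.GroupTheory.EstrangementDepth.exists_level_mul_inter_mul_subset N hopen hdir
    hbot hM hA hA hest j₀
  refine ⟨max (max k₁ j₀) j, (le_max_right _ _).trans (le_max_left _ _), le_max_right _ _,
    fun k' hk' P β₁ β₂ hβ₁b hβ₂b hβ₁ hβ₂ hfix₁ hfix₂ hjk' => ?_⟩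
  have hk₁k' : k₁ ≤ k' := ((le_max_left _ _).trans (le_max_left _ _)).trans hk'
  have hj₀k' : j₀ ≤ k' := ((le_max_right _ _).trans (le_max_left _ _)).trans hk'
  by_contra hne
  -- the two branches in cover coordinates: `βᵢ = treeIso (brOf b (gᵢ · P.pt k'))`
  have hbr : ∀ (β : (D.tree k').Branch), (D.treeProj k').branchMap β = b →
      (D.tree k').abuts β = some (P.vertex k') →
      ∃ g : 𝒢.Gv w, β = (D.treeIso hcnt k').hom.branchMap
        ((D.cover hcnt k').brOf b hb (((D.cover hcnt k').SV w).obj.ρ g (P.pt k'))) := by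
    intro β hβb hβ
    set β₀ := (D.treeIso hcnt k').inv.branchMap β with hβ₀
    have hβeq : β = (D.treeIso hcnt k').hom.branchMap β₀ := (D.treeIso_hom_branchMap_inv hcnt k' β).symm
    have hβ₀b : β₀.1.1 = b := by rw [← hβb, hβeq, D.treeProj_branchMap_treeIso hcnt]
    obtain ⟨y, hy⟩ := (D.cover hcnt k').exists_eq_brOf b hb β₀ hβ₀b
    have habut : (D.cover hcnt k').orbitGraph.abuts β₀ = some (Quot.mk _ ⟨w, P.pt k'⟩) := by
      apply D.orbitGraph_abuts_of_tree_abuts hcnt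
      rw [← hβeq]
      exact hβ
    rw [hy, (D.cover hcnt k').abuts_brOf b hb y] at habut
    obtain ⟨g, hg⟩ := (D.cover hcnt k').exists_ρ_of_mk_eq_mk (Option.some.inj habut).symm
    exact ⟨g, by rw [hβeq, hy, ← hg]⟩
  obtain ⟨g₁, hg₁⟩ := hbr β₁ hβ₁b hβ₁
  obtain ⟨g₂, hg₂⟩ := hbr β₂ hβ₂b hβ₂
  -- the linked dictionary at level `k'`
  rw [hg₁] at hfix₁
  rw [hg₂] at hfix₂
  obtain ⟨k₁', e₁⟩ := P.exists_gal_conj_brHom_of_edgeMap_brOf_eq k' c b hb g₁ hfix₁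
  obtain ⟨k₂', e₂⟩ := P.exists_gal_conj_brHom_of_edgeMap_brOf_eq k' c b hb g₂ hfix₂
  set h₁ : 𝒢.Gv w := g₁⁻¹ * 𝒢.brHom b w hb k₁' * g₁⁻¹⁻¹ with hh₁
  set h₂ : 𝒢.Gv w := g₂⁻¹ * 𝒢.brHom b w hb k₂' * g₂⁻¹⁻¹ with hh₂
  -- `h₁⁻¹ h₂` fixes `P.pt k'`, hence lies in `N k'`
  have hgal : P.gal k' h₁ = P.gal k' h₂ := e₁.symm.trans e₂
  have hNk : h₁⁻¹ * h₂ ∈ N k' :=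
    D.mem_levelKernel_of_fixes hcnt w N hN k' _ (P.pt k') ((P.gal_eq_gal_iff k' h₁ h₂).mp hgal)
  -- the relative conjugator `m := g₁ g₂⁻¹` is «distinct at level j»: `m ∉ Π_b · N j`
  have hm : g₁ * g₂⁻¹ ∈ M := by
    intro hmem
    obtain ⟨a, ha, ν, hν, hmeq⟩ := Set.mem_mul.mp hmem
    apply hne
    rw [hg₁, hg₂, P.treeTrans_branchMap_brOf_smul_pt b hb g₁ hjk', P.treeTrans_branchMap_brOf_smul_pt b hb g₂ hjk']
    congr 1
    symm
    rw [(D.cover hcnt j).brOf_eq_brOf_iff b hb]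
    refine ⟨a, ha, ?_⟩
    -- `a · (g₂ · pt_j) = g₁ · pt_j` since `g₁ = a ν g₂` and `ν` fixes every point of the fibre
    have hg₁eq : g₁ = a * ν * g₂ := by rw [hmeq, inv_mul_cancel_right]
    have hνfix : ((D.cover hcnt j).SV w).obj.ρ ν (((D.cover hcnt j).SV w).obj.ρ g₂ (P.pt j)) =
        ((D.cover hcnt j).SV w).obj.ρ g₂ (P.pt j) :=
      D.fixes_of_mem_levelKernel hcnt w N hN j ν hν _
    rw [hg₁eq, ρ_mul_apply, ρ_mul_apply, hνfix]
  -- `y := g₁ h₁ g₁⁻¹ = b_*(k₁') ∈ A·N ∩ (m A m⁻¹)·N` at level `k'`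
  set y : 𝒢.Gv w := g₁ * h₁ * g₁⁻¹ with hy
  have hyA : y ∈ A * (N k' : Set (𝒢.Gv w)) := by
    refine Set.mem_mul.mpr ⟨𝒢.brHom b w hb k₁', ⟨k₁', rfl⟩, 1, (N k').one_mem, ?_⟩
    rw [hy, hh₁]; group
  have hyB : y ∈ ((fun a => (g₁ * g₂⁻¹) * a * (g₁ * g₂⁻¹)⁻¹) '' A) * (N k' : Set (𝒢.Gv w)) := by
    refine Set.mem_mul.mpr ⟨(g₁ * g₂⁻¹) * 𝒢.brHom b w hb k₂' * (g₁ * g₂⁻¹)⁻¹,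
      ⟨𝒢.brHom b w hb k₂', ⟨k₂', rfl⟩, rfl⟩, g₁ * (h₁⁻¹ * h₂)⁻¹ * g₁⁻¹, ?_, ?_⟩
    · exact (hnormal k').conj_mem _ ((N k').inv_mem hNk) g₁
    · rw [hy, hh₁, hh₂]; group
  -- depth: `y ∈ N j₀`, hence `h₁ ∈ N j₀`
  have hyN : y ∈ (N j₀ : Set (𝒢.Gv w)) := hk₁ k' (hanti hk₁k') (g₁ * g₂⁻¹) hm y hyA hyB
  have hh₁N : h₁ ∈ N j₀ := by
    have h := (hnormal j₀).conj_mem _ hyN g₁⁻¹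
    have hcalc : g₁⁻¹ * y * g₁⁻¹⁻¹ = h₁ := by rw [hy]; group
    rwa [hcalc] at h
  -- hence `σ_{j₀}^{h₁} = 1` and `ρ_{j₀}(c) = 1`
  have hgal₀ : P.gal j₀ h₁ = 1 :=
    (P.gal_eq_one_iff j₀ h₁).mpr (D.fixes_of_mem_levelKernel hcnt w N hN j₀ h₁ hh₁N (P.pt j₀))
  have hproj : D.proj hcnt j₀ c = P.gal j₀ h₁ := by
    rw [← D.mapLE_proj hcnt hj₀k' c, e₁]
    exact D.mapLE_of_step hcnt (fun n => P.gal n h₁) (fun n => P.step_gal n h₁) hj₀k'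
  exact hc (hproj.trans hgal₀)

end Canonical

end ProfiniteSemiGraph

end Literature.AnabelianGeometry.SemiGraphs
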